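import Summits.CriticalPhenomena.PercolationContinuityZ3.Theorems.PercNearOneGluingNoHeavyQuantFarSunCfgKronShared
import HarnessLib

/-!
# FAR beyond trees: per-`K` configuration-level certificates — generic TYPED certificate readers (class `cy⟨cR⟩⟨cD⟩⟨de⟩`)

builds on p205010 (kernel theorem, internal audit signed; external expert review pending)

Support file (`--supports stmt-CriticalPhenomena-4575`), seat `prim-cert-1` (gen 26); memo `prim-cert-1/FROM-prim-cert-1-g26-CONFIG-CERTS.md` §7.
`TK.cyA532 / TK.cyB532` (`…QuantFarSunCfgProducts`) read the typed class `cy532` of the layer-2 LPs (caps `#reached ∧ 5`, `#duds ∧ 3`, `dend ∧ 2`).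
At layer `j` the relevant position type is `dend ∧ j` (memo §5 N9) and the count caps grow, so the layer-3/4 certificates live in classes `cy653`,
`cy754`, …  This file provides the readers for an arbitrary cap triple `(cR, cD, de)` and their prefix invariance (for `TK.sunFAR_of_kronL2'`):
* `TK.cyAg cR cD de K tab`, `TK.cyBg cR cD K tab` — radix `((((st·3 + rg)·(de+1) + dend∧de)·(cR+1) + n∧cR)·(cD+1) + d∧cD)·2 + full` resp.
  `((n∧cR)·(cD+1) + d∧cD)·2 + full` (same feature conventions as `cyA532`);
* `TK.prefixInv_cyg`.
No sorries; standard axioms; nothing here asserts anything about a particular certificate.  Elementary [this work].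
-/

namespace Summit.CriticalPhenomena.PercolationContinuityZ3.Theorems.HairyCycle

namespace TK

/-- Generic typed `a`-multiplier reader of class `cy⟨cR⟩⟨cD⟩⟨de⟩`: radix table over (status of `k` ∈ {reached, dud, uncovered}, region ∈ {P, S, M},
`min(dist to end, de)`, `min(#reached, cR)`, `min(#duds, cD)`, full-coverage flag). [this work] -/
def cyAg (cR cD de K : ℕ) (tab : Array ℕ) (k q m m' : ℕ) : ℕ :=
  let cm := covM K m m'
  let full : Bool := cm == 2 ^ K - 1
  let r := q &&& cm
  let dd := cm ^^^ r
  let st : ℕ := if r.testBit k then 0 else if dd.testBit k then 1 else 2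
  let rg : ℕ := if full then 0 else if k < m then 0 else if m' ≤ k then 1 else 2
  let dn := min (min k (K - 1 - k)) de
  tab.getD (((((st * 3 + rg) * (de + 1) + dn) * (cR + 1) + min (pc r) cR) * (cD + 1) + min (pc dd) cD) * 2 + (if full then 1 else 0)) 0

/-- Generic typed `b`-multiplier reader (radix table over `min(#reached, cR)`, `min(#duds, cD)`, full flag). [this work] -/
def cyBg (cR cD K : ℕ) (tab : Array ℕ) (q m m' : ℕ) : ℕ :=
  let cm := covM K m m'
  let full : Bool := cm == 2 ^ K - 1
  let r := q &&& cm
  let dd := cm ^^^ r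
  tab.getD ((min (pc r) cR * (cD + 1) + min (pc dd) cD) * 2 + (if full then 1 else 0)) 0

/-- The generic typed reader is prefix-invariant (`TK.PrefixInv`). [this work] -/
theorem prefixInv_cyg (cR cD de K : ℕ) (tA tB : Array ℕ) : PrefixInv K (cyAg cR cD de K tA) (cyBg cR cD K tB) := by
  constructor
  · intro k q m'
    unfold cyAg
    simp only [covM_succ_self, covM_self, beq_self_eq_true, ite_true]
  · intro q m'
    unfold cyBg
    simp only [covM_succ_self]

end TK

end Summit.CriticalPhenomena.PercolationContinuityZ3.Theorems.HairyCycle
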